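import Literature.NumberTheory.ComplexMultiplication.TateHypEllPowerTowerOfCMElliptic
import Literature.NumberTheory.DiophantineGeometry.AVIsogenyTateHoldsProofs
import HarnessLib

/-!
# [Faltings 1983, §5 Kor. 1] for the endomorphisms of a CM elliptic structure, by CM theory

Theorems only (topic `NumberTheory/ComplexMultiplication`; no definition, no named fact).

For a structure `(A₀, ι₀ : 𝓞_K → End A₀)` of CM type `(K, Φ)` over a number field `k`
(`IsCMTypeRealisationOver Φ A₀ ι₀`; CM by the maximal order, defined over `k ⊇ K*`) with
`[K : ℚ] = 2` — a CM elliptic curve with its complex multiplication defined over `k` — and every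
prime `ℓ`, the Tate map `ℤ_ℓ ⊗ End_k(A₀) → End_{Γ_k}(T_ℓ A₀)` is BIJECTIVE
(`faltings_tate_bijective A₀ A₀ ℓ`, the text of [Fal83 §5 Kor. 1] = row VI-1 of the cell's floor,
here at a CM-elliptic pair), granted [Shimura 1998, Thm. 18.6] (`shimura1998_thm18_6`, a theorem
of the tree Summits-side).  No use of [Fal83]: J.-P. Serre, J. Tate, *Good reduction of abelian
varieties* (1968), §4 Thm. 5 / Cor. 1 («the commutant of `R` in `End(T_ℓ)` is `R_ℓ`»; Shimura 1998
§5.1 Prop. 3) in the rank-one principal form: a `Γ_k`-equivariant `λ ∈ End_{ℤ_ℓ}(T_ℓ A₀)` commutes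
with the Frobenius image `T_ℓ(ι₀ π)`, `ℚ(π) = K` (`exists_tateRep_eq_tateModuleMap_and_adjoin_eq_top`:
Shimura–Taniyama at a degree-one place), hence with `disc · T_ℓ(ι₀ a)` for all `a ∈ 𝓞_K`
(`exists_int_mul_mem_adjoin_of_adjoin_eq_top`), hence with every `T_ℓ(ι₀ a)`; on the `ℤ_ℓ`-basis
`T_ℓ(ι₀ b_k) t₀` of `T_ℓ A₀` (`IsCMTypeRealisationOver.exists_basis_eq_tateModuleMap_apply`) it is
therefore `Σ c_k T_ℓ(ι₀ b_k)`, an element of the image; injectivity is Mumford §19 Thm. 3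
(`faltingsTateMap_injective_holds`).

* `bijective_faltingsTateMap_of_isCMTypeRealisationOver_of_tateRep_eq` — the commutant argument,
  for any CM field `K`, given one `σ₀` with `ρ_ℓ(σ₀) = T_ℓ(ι₀ π)`, `ℚ(π) = K`.
* `faltings_tate_bijective_of_CM_elliptic_of_thm18_6` — the CM elliptic head behind `h186`
  (T5 §6.5′ of the cell hodgecm-mathlib: first decided instance of the VI-1 residual text).

## References

* [SerreTate1968] J.-P. Serre, J. Tate, Ann. of Math. 88 (1968), §4 Theorem 5, Corollaries 1–2.
* [Shimura1998] G. Shimura, *Abelian Varieties with Complex Multiplication and Modular Functions*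
  (1998), §5.1 Proposition 3; §18.6 Theorem 18.6.
* [Faltings1983Endlichkeit] G. Faltings, Invent. Math. 73 (1983), §5 Korollar 1 (the statement decided).
-/

noncomputable section

open CategoryTheory Polynomial
open scoped NumberField Pointwise IntermediateField TensorProduct

namespace Literature.NumberTheory.ComplexMultiplication

open Literature.AlgebraicGeometry.Motives Literature.AlgebraicGeometry.Motives.AbelianVariety

/-! ## The commutant argument and the CM elliptic head -/

/-- **Tate's conjecture for `End` of a CM structure whose Galois image contains `T_ℓ(ι₀ π)` with
`ℚ(π) = K`** (Serre–Tate 1968 §4 Thm. 5 / Cor. 1 in the principal, rank-one case; Shimura 1998 §5.1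
Prop. 3 «`ι(F)` is its own commutant»): for `(A₀, ι₀)` of CM type `(K, Φ)` over a number field `k`,
if some `σ₀ ∈ Γ_k` acts on `T_ℓ A₀` as `T_ℓ(ι₀ π)` with `ℚ(π) = K`, then
`ℤ_ℓ ⊗ End_k(A₀) → End_{Γ_k}(T_ℓ A₀)` is bijective: a `Γ_k`-equivariant `λ` commutes with
`ℤ[T_ℓ(ι₀ π)] ∋ disc · T_ℓ(ι₀ a)`, hence with every `T_ℓ(ι₀ a)`, hence is `Σ c_k T_ℓ(ι₀ b_k)` on the
`ℤ_ℓ`-basis `T_ℓ(ι₀ b_k) t₀` of `T_ℓ A₀`; injectivity is Mumford §19 Thm. 3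
(`faltingsTateMap_injective_holds`). [cite: SerreTate1968, §4 Theorem 5 and Corollary 1]
[cite: Shimura1998, §5.1 Proposition 3] -/
theorem bijective_faltingsTateMap_of_isCMTypeRealisationOver_of_tateRep_eq
    {k : Type} [Field k] [NumberField k] [Algebra k ℂ] {K : Type} [Field K] [NumberField K]
    [NumberField.IsCMField K] (Φ : CMType K) (A₀ : AbelianVariety k) (ι₀ : 𝓞 K →+* End A₀)
    (hA : IsCMTypeRealisationOver Φ A₀ ι₀) (ℓ : ℕ) [Fact ℓ.Prime]
    (σ₀ : Field.absoluteGaloisGroup k) (π : 𝓞 K)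
    (hσ₀ : A₀.tateRep ℓ σ₀ = tateModuleMap ℓ (ι₀ π : A₀ ⟶ A₀)) (hπ : ℚ⟮(π : K)⟯ = ⊤) :
    Function.Bijective (faltingsTateMap A₀ A₀ ℓ) := by
  classical
  have hℓk : (ℓ : k) ≠ 0 := Nat.cast_ne_zero.mpr (Fact.out : ℓ.Prime).ne_zero
  refine ⟨faltingsTateMap_injective_holds A₀ A₀ ℓ hℓk, fun g => ?_⟩
  -- `T_ℓ ∘ ι₀` as a ring homomorphism
  let ι : 𝓞 K →+* Module.End ℤ_[ℓ] (A₀.tateModule ℓ) :=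
    { toFun := fun a => tateModuleMap ℓ (ι₀ a : A₀ ⟶ A₀)
      map_one' := by simp only [map_one]; exact tateModuleMap_id ℓ A₀
      map_mul' := fun a b => by
        simp only [map_mul]
        change tateModuleMap ℓ ((ι₀ b : A₀ ⟶ A₀) ≫ (ι₀ a : A₀ ⟶ A₀)) = _
        rw [tateModuleMap_comp]; rfl
      map_zero' := by simp only [map_zero]; exact tateModuleMap_zero ℓ
      map_add' := fun a b => by simp only [map_add]; exact tateModuleMap_add ℓ _ _ }
  have hι : ∀ a, ι a = tateModuleMap ℓ (ι₀ a : A₀ ⟶ A₀) := fun a => rfl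
  -- the equivariant map `λ` commutes with `ρ(σ₀) = ι π`, hence with every `ι a`
  set lam : Module.End ℤ_[ℓ] (A₀.tateModule ℓ) := g.toLinearMap with hlam
  have hcommσ : Commute lam (ι π) := by
    rw [hι, ← hσ₀]
    refine LinearMap.ext fun t => ?_
    exact Representation.IntertwiningMap.isIntertwining _ _ g σ₀ t
  have hcommpol : ∀ p : ℤ[X], Commute lam (aeval (ι π) p) := fun p => by
    induction p using Polynomial.induction_on' with
    | add p q hp hq => rw [map_add]; exact hp.add_right hq
    | monomial n c =>
      rw [aeval_monomial, eq_intCast]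
      exact Commute.mul_right Commute.intCast_right (hcommσ.pow_right n)
  obtain ⟨z, hz0, hz⟩ := exists_int_mul_mem_adjoin_of_adjoin_eq_top π hπ
  have hzℓ : ((z : ℤ_[ℓ])) ≠ 0 := Int.cast_ne_zero.mpr hz0
  have hcomm : ∀ a : 𝓞 K, Commute lam (ι a) := by
    intro a
    obtain ⟨p, hp⟩ := hz a
    have h1 : Commute lam (ι ((z : 𝓞 K) * a)) := by
      rw [hp]
      change Commute lam (ι.toIntAlgHom (aeval π p))
      rw [← aeval_algHom_apply]
      exact hcommpol p
    refine LinearMap.ext fun t => ?_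
    apply smul_right_injective (A₀.tateModule ℓ) hzℓ
    have h2 := congrArg (fun φ : Module.End ℤ_[ℓ] (A₀.tateModule ℓ) => φ t) h1.eq
    simp only [map_mul, map_intCast, Module.End.mul_apply, Module.End.intCast_apply,
      ← Int.cast_smul_eq_zsmul ℤ_[ℓ]] at h2
    simp only [Module.End.mul_apply]
    rw [← map_smul]
    exact h2
  -- read `λ t₀` in the basis `T_ℓ(ι₀ b_k) t₀`
  obtain ⟨t₀, Bas, hBas⟩ := hA.exists_basis_eq_tateModuleMap_apply ℓ
  set c : Module.Free.ChooseBasisIndex ℤ (𝓞 K) →₀ ℤ_[ℓ] := Bas.repr (lam t₀) with hc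
  refine ⟨∑ j, c j ⊗ₜ[ℤ] (ι₀ (NumberField.RingOfIntegers.basis K j) : A₀ ⟶ A₀), ?_⟩
  apply Representation.IntertwiningMap.ext
  refine Bas.ext fun j => ?_
  rw [map_sum]
  simp only [faltingsTateMap_tmul]
  change (∑ x, c x • homToTate A₀ A₀ ℓ (ι₀ (NumberField.RingOfIntegers.basis K x) : A₀ ⟶ A₀)) (Bas j) =
    lam (Bas j)
  rw [Representation.IntertwiningMap.sum_apply]
  simp only [Representation.IntertwiningMap.smul_apply, homToTate_apply_apply]
  -- both sides equal `T_ℓ(ι₀ b_j) (λ t₀)`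
  have hR : lam (Bas j) = ι (NumberField.RingOfIntegers.basis K j) (lam t₀) := by
    rw [hBas j, ← hι]
    exact congrArg (fun φ : Module.End ℤ_[ℓ] (A₀.tateModule ℓ) => φ t₀)
      (hcomm (NumberField.RingOfIntegers.basis K j)).eq
  have hL : ∀ x, tateModuleMap ℓ (ι₀ (NumberField.RingOfIntegers.basis K x) : A₀ ⟶ A₀) (Bas j) =
      ι (NumberField.RingOfIntegers.basis K j) (Bas x) := by
    intro x
    rw [hBas j, hBas x, ← hι, ← hι, ← Module.End.mul_apply, ← map_mul, mul_comm, map_mul,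
      Module.End.mul_apply]
  simp only [hL, ← map_smul]
  rw [← map_sum, hR]
  congr 1
  conv_rhs => rw [← Bas.sum_repr (lam t₀)]

/-- **[Faltings 1983, §5 Kor. 1] for the endomorphisms of a CM elliptic structure over a number
field, without invoking [Fal83]** — granted [Shimura 1998, Thm. 18.6]: for `(A₀, ι₀)` of CM type
`(K, Φ)` over `k` with `[K : ℚ] = 2` and every prime `ℓ`, the Tate map
`ℤ_ℓ ⊗ End_k(A₀) → End_{Γ_k}(T_ℓ A₀)` is bijective (`faltings_tate_bijective A₀ A₀ ℓ` — an INSTANCE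
of the floor's row VI-1 text decided by CM theory: Shimura–Taniyama Frobenius at a degree-one place,
`exists_tateRep_eq_tateModuleMap_and_adjoin_eq_top`, then Serre–Tate §4 Cor. 1 in the rank-one form
`bijective_faltingsTateMap_of_isCMTypeRealisationOver_of_tateRep_eq`).
[cite: SerreTate1968, §4 Theorem 5 and Corollary 1] [cite: Shimura1998, §5.1 Proposition 3; §18.6 Theorem 18.6] -/
theorem faltings_tate_bijective_of_CM_elliptic_of_thm18_6 (h186 : shimura1998_thm18_6) :
    ∀ {k : Type} [Field k] [Algebra k ℂ] {K : Type} [Field K] [NumberField K]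
      [NumberField.IsCMField K] (Φ : CMType K) (A₀ : AbelianVariety k) (ι₀ : 𝓞 K →+* End A₀),
      IsCMTypeRealisationOver Φ A₀ ι₀ → Module.finrank ℚ K = 2 →
      ∀ (ℓ : ℕ) [Fact ℓ.Prime], faltings_tate_bijective A₀ A₀ ℓ := by
  intro k _ _ K _ _ _ Φ A₀ ι₀ hA h2 ℓ _ _
  obtain ⟨σ₀, π, hσ₀, hπ⟩ := exists_tateRep_eq_tateModuleMap_and_adjoin_eq_top h186 Φ A₀ ι₀ hA h2 ℓ
  exact bijective_faltingsTateMap_of_isCMTypeRealisationOver_of_tateRep_eq Φ A₀ ι₀ hA ℓ σ₀ π hσ₀ hπ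

end Literature.NumberTheory.ComplexMultiplication

end
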